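import Summits.CriticalPhenomena.Ising3DConformalLimit.Theses.FKParityRobustness
import Literature.Probability.LatticeModels.ModifiedSimonInequality
import HarnessLib

/-!
# The source cluster of a `T`-join and the fibre bijection `F ↦ (K_x(F), F ∖ K_x(F))`

Helper file for item `DepletionBound` (stmt-CriticalPhenomena-14628) of route `FKParityRobustness`
(adapted from the standing disprover's work file `Cruxes/StrandShadow/Disproof.lean`, §4a, where the
same decomposition proves the pair-split deletion identity; restated here without auxiliary
definitions so that it can be imported by `Theorems/` files).

For an edge set `F` of the finite graph `G` and a vertex `x` write `x ↝_F v` for reachability in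
`fromEdgeSet F`, `K_x(F) = {e ∈ F : some endpoint of e is F-reachable from x}` for the edge set of
the `F`-component of `x` (the SOURCE CLUSTER when `x` is a source of `F`), `deg_F(v)` for the
`F`-degree and `Λ_K = {v : ¬ x ↝_K v}` for the DEPLETED VOLUME of a cluster `K`.

* reachability bookkeeping (`rch_step`, `rch_union_iff`: adding edges avoiding the cluster does not
  change what is reachable), the cluster `K_x(F)` (`rch_cluster_iff`, `filter_cluster_idem`,
  `filter_cluster_union_eq`), degrees (`card_filter_mem_union`, …), the handshake lemma
  `even_card_odd_degree`, and the parity transfer between `F` and `K_x(F)` (`odd_deg_cluster_iff`);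
* **`fibre_sum`**: for a self-clustered `K ⊆ E(G)` at `x` (`K_x(K) = K`) with odd-degree set `S₀`
  and a terminal set `T ⊆ Λ_K`, the map `F ↦ F ∖ K` is a bijection from the `T`-joins of `G` with
  terminal set `S₀ ∪ T` whose `x`-cluster is `K` onto the edge sets `R ⊆ ℰ_{Λ_K}` with
  `oddVerts Λ_K R = T`, with inverse `R ↦ K ∪ R`; stated as an equality of sums.
-/

noncomputable section

namespace Summit.CriticalPhenomena.Ising3DConformalLimit.Theorems.DepletionBound

open scoped Classical
open Finset
open Literature.Probability.LatticeModels

section Graph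

variable {V : Type*} [Fintype V] [DecidableEq V]

omit [Fintype V] [DecidableEq V] in
/-- Reachability is reflexive. -/
theorem rch_refl (F : Finset (Sym2 V)) (x : V) : (SimpleGraph.fromEdgeSet ((F : Finset (Sym2 V)) : Set (Sym2 V))).Reachable x x := SimpleGraph.Reachable.refl x

omit [Fintype V] [DecidableEq V] in
/-- Reachability is monotone in the edge set. -/
theorem rch_mono {F F' : Finset (Sym2 V)} (h : F ⊆ F') {x v : V} (hr : (SimpleGraph.fromEdgeSet ((F : Finset (Sym2 V)) : Set (Sym2 V))).Reachable x v) : (SimpleGraph.fromEdgeSet ((F' : Finset (Sym2 V)) : Set (Sym2 V))).Reachable x v :=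
  SimpleGraph.Reachable.mono (SimpleGraph.fromEdgeSet_mono (Finset.coe_subset.2 h)) hr

omit [Fintype V] in
/-- One more edge: if `u` is reachable and `e ∈ F` contains `u` and `v`, then `v` is reachable. -/
theorem rch_step {F : Finset (Sym2 V)} {x u v : V} {e : Sym2 V} (he : e ∈ F) (hu : u ∈ e)
    (hv : v ∈ e) (hxu : (SimpleGraph.fromEdgeSet ((F : Finset (Sym2 V)) : Set (Sym2 V))).Reachable x u) : (SimpleGraph.fromEdgeSet ((F : Finset (Sym2 V)) : Set (Sym2 V))).Reachable x v := by
  by_cases huv : u = v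
  · exact huv ▸ hxu
  · have hadj : (SimpleGraph.fromEdgeSet (↑F : Set (Sym2 V))).Adj u v := by
      rw [SimpleGraph.fromEdgeSet_adj]
      refine ⟨?_, huv⟩
      have : e = s(u, v) := (Sym2.mem_and_mem_iff huv).1 ⟨hu, hv⟩
      rw [← this]
      exact Finset.mem_coe.2 he
    exact SimpleGraph.Reachable.trans hxu hadj.reachable

omit [Fintype V] in
/-- Adding edges none of whose endpoints is `K`-reachable from `x` does not change what is
reachable from `x`. -/
theorem rch_union_iff {K R : Finset (Sym2 V)} {x : V} (hR : ∀ e ∈ R, ∀ v ∈ e, ¬ (SimpleGraph.fromEdgeSet ((K : Finset (Sym2 V)) : Set (Sym2 V))).Reachable x v)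
    (v : V) : (SimpleGraph.fromEdgeSet ((K ∪ R : Finset (Sym2 V)) : Set (Sym2 V))).Reachable x v ↔ (SimpleGraph.fromEdgeSet ((K : Finset (Sym2 V)) : Set (Sym2 V))).Reachable x v := by
  refine ⟨fun h => ?_, rch_mono subset_union_left⟩
  rw [SimpleGraph.reachable_iff_reflTransGen] at h
  induction h with
  | refl => exact rch_refl K x
  | tail _ hbc ih =>
    rw [SimpleGraph.fromEdgeSet_adj] at hbc
    obtain ⟨hmem, _⟩ := hbc
    rcases Finset.mem_union.1 (Finset.mem_coe.1 hmem) with hK | hRR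
    · exact rch_step hK (Sym2.mem_mk_left _ _) (Sym2.mem_mk_right _ _) ih
    · exact absurd ih (hR _ hRR _ (Sym2.mem_mk_left _ _))

/-- The cluster is a subset of the edge set. -/
theorem filter_cluster_subset (F : Finset (Sym2 V)) (x : V) : (Finset.filter (fun e => ∃ v ∈ e, (SimpleGraph.fromEdgeSet ((F : Finset (Sym2 V)) : Set (Sym2 V))).Reachable x v) F) ⊆ F :=
  filter_subset _ _

/-- The edges of `F` off the cluster of `x` avoid the vertices reachable inside the cluster. -/
theorem sdiff_cluster_avoid (F : Finset (Sym2 V)) (x : V) :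
    ∀ e ∈ F \ (Finset.filter (fun e => ∃ v ∈ e, (SimpleGraph.fromEdgeSet ((F : Finset (Sym2 V)) : Set (Sym2 V))).Reachable x v) F), ∀ v ∈ e, ¬ (SimpleGraph.fromEdgeSet (((Finset.filter (fun e => ∃ v ∈ e, (SimpleGraph.fromEdgeSet ((F : Finset (Sym2 V)) : Set (Sym2 V))).Reachable x v) F) : Finset (Sym2 V)) : Set (Sym2 V))).Reachable x v := by
  intro e he v hv hr
  rw [mem_sdiff, mem_filter] at he
  exact he.2 ⟨he.1, v, hv, rch_mono (filter_cluster_subset F x) hr⟩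

/-- Reachability from `x` inside the cluster of `x` is reachability inside `F`. -/
theorem rch_cluster_iff (F : Finset (Sym2 V)) (x v : V) :
    (SimpleGraph.fromEdgeSet (((Finset.filter (fun e => ∃ v ∈ e, (SimpleGraph.fromEdgeSet ((F : Finset (Sym2 V)) : Set (Sym2 V))).Reachable x v) F) : Finset (Sym2 V)) : Set (Sym2 V))).Reachable x v ↔ (SimpleGraph.fromEdgeSet ((F : Finset (Sym2 V)) : Set (Sym2 V))).Reachable x v := by
  have h := rch_union_iff (sdiff_cluster_avoid F x) v
  rw [union_sdiff_of_subset (filter_cluster_subset F x)] at h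
  exact h.symm

/-- The cluster of `x` is self-clustered. -/
theorem filter_cluster_idem (F : Finset (Sym2 V)) (x : V) :
    (Finset.filter (fun e => ∃ v ∈ e, (SimpleGraph.fromEdgeSet (((Finset.filter (fun e => ∃ v ∈ e, (SimpleGraph.fromEdgeSet ((F : Finset (Sym2 V)) : Set (Sym2 V))).Reachable x v) F) : Finset (Sym2 V)) : Set (Sym2 V))).Reachable x v) ((Finset.filter (fun e => ∃ v ∈ e, (SimpleGraph.fromEdgeSet ((F : Finset (Sym2 V)) : Set (Sym2 V))).Reachable x v) F))) = (Finset.filter (fun e => ∃ v ∈ e, (SimpleGraph.fromEdgeSet ((F : Finset (Sym2 V)) : Set (Sym2 V))).Reachable x v) F) := by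
  ext e
  constructor
  · intro h
    exact (mem_filter.1 h).1
  · intro h
    have h' := h
    rw [mem_filter] at h'
    obtain ⟨_, v, hv, hr⟩ := h'
    exact mem_filter.2 ⟨h, v, hv, (rch_cluster_iff F x v).2 hr⟩

/-- Adding to a self-clustered `K` an edge set avoiding its vertices leaves the cluster `K`. -/
theorem filter_cluster_union_eq {K R : Finset (Sym2 V)} {x : V} (hK : (Finset.filter (fun e => ∃ v ∈ e, (SimpleGraph.fromEdgeSet ((K : Finset (Sym2 V)) : Set (Sym2 V))).Reachable x v) K) = K)
    (hR : ∀ e ∈ R, ∀ v ∈ e, ¬ (SimpleGraph.fromEdgeSet ((K : Finset (Sym2 V)) : Set (Sym2 V))).Reachable x v) : (Finset.filter (fun e => ∃ v ∈ e, (SimpleGraph.fromEdgeSet ((K ∪ R : Finset (Sym2 V)) : Set (Sym2 V))).Reachable x v) (K ∪ R)) = K := by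
  ext e
  rw [mem_filter, mem_union]
  simp_rw [rch_union_iff hR]
  constructor
  · rintro ⟨hKR | hRR, v, hv, hr⟩
    · exact hKR
    · exact absurd hr (hR e hRR v hv)
  · intro he
    refine ⟨Or.inl he, ?_⟩
    have he' : e ∈ (Finset.filter (fun e => ∃ v ∈ e, (SimpleGraph.fromEdgeSet ((K : Finset (Sym2 V)) : Set (Sym2 V))).Reachable x v) K) := by rw [hK]; exact he
    exact (mem_filter.1 he').2

/-- Every endpoint of an edge of a self-clustered `K` is reachable. -/
theorem rch_of_mem_of_self {K : Finset (Sym2 V)} {x : V} (hK : (Finset.filter (fun e => ∃ v ∈ e, (SimpleGraph.fromEdgeSet ((K : Finset (Sym2 V)) : Set (Sym2 V))).Reachable x v) K) = K)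
    {e : Sym2 V} (he : e ∈ K) {v : V} (hv : v ∈ e) : (SimpleGraph.fromEdgeSet ((K : Finset (Sym2 V)) : Set (Sym2 V))).Reachable x v := by
  have he' : e ∈ (Finset.filter (fun e => ∃ v ∈ e, (SimpleGraph.fromEdgeSet ((K : Finset (Sym2 V)) : Set (Sym2 V))).Reachable x v) K) := by rw [hK]; exact he
  obtain ⟨-, u, hu, hxu⟩ := mem_filter.1 he'
  exact rch_step he hu hv hxu

omit [Fintype V] in
/-- Degrees add over disjoint edge sets. -/
theorem card_filter_mem_union {K R : Finset (Sym2 V)} (h : Disjoint K R) (v : V) :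
    #(Finset.filter (fun e => v ∈ e) (K ∪ R)) = #(Finset.filter (fun e => v ∈ e) K) + #(Finset.filter (fun e => v ∈ e) R) := by
  rw [filter_union, card_union_of_disjoint (disjoint_filter_filter h)]

omit [Fintype V] in
/-- A vertex on no edge of `R` has `R`-degree `0`. -/
theorem card_filter_mem_eq_zero_of_avoid {R : Finset (Sym2 V)} {v : V} (h : ∀ e ∈ R, v ∉ e) :
    #(Finset.filter (fun e => v ∈ e) R) = 0 := by
  rw [card_eq_zero, filter_eq_empty_iff]
  exact fun e he => h e he

/-- An unreachable vertex has degree `0` in a self-clustered `K`. -/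
theorem card_filter_mem_eq_zero_of_not_rch {K : Finset (Sym2 V)} {x v : V} (hK : (Finset.filter (fun e => ∃ v ∈ e, (SimpleGraph.fromEdgeSet ((K : Finset (Sym2 V)) : Set (Sym2 V))).Reachable x v) K) = K)
    (hv : ¬ (SimpleGraph.fromEdgeSet ((K : Finset (Sym2 V)) : Set (Sym2 V))).Reachable x v) : #(Finset.filter (fun e => v ∈ e) K) = 0 :=
  card_filter_mem_eq_zero_of_avoid fun _ he hve => hv (rch_of_mem_of_self hK he hve)

/-- A vertex of nonzero degree in a self-clustered `K` is reachable. -/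
theorem rch_of_card_filter_mem_ne_zero {K : Finset (Sym2 V)} {x v : V} (hK : (Finset.filter (fun e => ∃ v ∈ e, (SimpleGraph.fromEdgeSet ((K : Finset (Sym2 V)) : Set (Sym2 V))).Reachable x v) K) = K)
    (hv : #(Finset.filter (fun e => v ∈ e) K) ≠ 0) : (SimpleGraph.fromEdgeSet ((K : Finset (Sym2 V)) : Set (Sym2 V))).Reachable x v := by
  by_contra h
  exact hv (card_filter_mem_eq_zero_of_not_rch hK h)

/-- A self-clustered `K` is disjoint from any edge set avoiding its reachable vertices. -/
theorem disjoint_of_avoid {K R : Finset (Sym2 V)} {x : V} (hK : (Finset.filter (fun e => ∃ v ∈ e, (SimpleGraph.fromEdgeSet ((K : Finset (Sym2 V)) : Set (Sym2 V))).Reachable x v) K) = K)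
    (hR : ∀ e ∈ R, ∀ v ∈ e, ¬ (SimpleGraph.fromEdgeSet ((K : Finset (Sym2 V)) : Set (Sym2 V))).Reachable x v) : Disjoint K R := by
  rw [Finset.disjoint_left]
  intro e heK heR
  induction e using Sym2.ind with
  | _ a b => exact hR _ heR a (Sym2.mem_mk_left a b) (rch_of_mem_of_self hK heK (Sym2.mem_mk_left a b))

/-- Handshake: an edge finset without diagonal edges has an even number of odd-degree vertices. -/
theorem even_card_odd_degree {F : Finset (Sym2 V)} (hdiag : ∀ e ∈ F, ¬ e.IsDiag) :
    Even #(univ.filter fun v => Odd #(Finset.filter (fun e => v ∈ e) F)) := by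
  have htwo : ∀ e ∈ F, (Finset.univ.filter fun v : V => v ∈ e).card = 2 := by
    intro e he
    induction e using Sym2.ind with
    | _ a b =>
      have hab : a ≠ b := fun h => hdiag _ he (by simp [h])
      rw [Finset.card_eq_two]
      exact ⟨a, b, hab, by ext v; simp [Sym2.mem_iff]⟩
  have hsum : ∑ v, #(Finset.filter (fun e => v ∈ e) F) = 2 * F.card := by
    simp_rw [Finset.card_filter]
    rw [Finset.sum_comm]
    simp_rw [← Finset.card_filter]
    rw [Finset.sum_congr rfl htwo, Finset.sum_const, smul_eq_mul, mul_comm]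
  have heven : Even (∑ v, #(Finset.filter (fun e => v ∈ e) F)) := ⟨F.card, by rw [hsum]; ring⟩
  rwa [Finset.even_sum_iff_even_card_odd] at heven

omit [Fintype V] [DecidableEq V] in
/-- A nontrivially reachable vertex lies on an edge of `F`. -/
theorem exists_mem_of_rch {F : Finset (Sym2 V)} {x v : V} (h : (SimpleGraph.fromEdgeSet ((F : Finset (Sym2 V)) : Set (Sym2 V))).Reachable x v) (hxv : v ≠ x) :
    ∃ e ∈ F, v ∈ e := by
  rw [SimpleGraph.reachable_iff_reflTransGen] at h
  rcases Relation.ReflTransGen.cases_tail h with h | ⟨u, -, hadj⟩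
  · exact absurd h hxv
  · rw [SimpleGraph.fromEdgeSet_adj] at hadj
    exact ⟨s(u, v), Finset.mem_coe.1 hadj.1, Sym2.mem_mk_right u v⟩

/-- Parity transfer between `F` and its `x`-cluster at a reachable vertex. -/
theorem odd_deg_cluster_iff {F : Finset (Sym2 V)} {x v : V} (hv : (SimpleGraph.fromEdgeSet ((F : Finset (Sym2 V)) : Set (Sym2 V))).Reachable x v) :
    Odd #(Finset.filter (fun e => v ∈ e) ((Finset.filter (fun e => ∃ v ∈ e, (SimpleGraph.fromEdgeSet ((F : Finset (Sym2 V)) : Set (Sym2 V))).Reachable x v) F))) ↔ Odd #(Finset.filter (fun e => v ∈ e) F) := by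
  have hsplit : #(Finset.filter (fun e => v ∈ e) F) = #(Finset.filter (fun e => v ∈ e) ((Finset.filter (fun e => ∃ v ∈ e, (SimpleGraph.fromEdgeSet ((F : Finset (Sym2 V)) : Set (Sym2 V))).Reachable x v) F))) + #(Finset.filter (fun e => v ∈ e) (F \ (Finset.filter (fun e => ∃ v ∈ e, (SimpleGraph.fromEdgeSet ((F : Finset (Sym2 V)) : Set (Sym2 V))).Reachable x v) F))) := by
    rw [← card_filter_mem_union disjoint_sdiff, union_sdiff_of_subset (filter_cluster_subset F x)]
  have h0 : #(Finset.filter (fun e => v ∈ e) (F \ (Finset.filter (fun e => ∃ v ∈ e, (SimpleGraph.fromEdgeSet ((F : Finset (Sym2 V)) : Set (Sym2 V))).Reachable x v) F))) = 0 :=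
    card_filter_mem_eq_zero_of_avoid fun e he hve =>
      sdiff_cluster_avoid F x e he v hve ((rch_cluster_iff F x v).2 hv)
  rw [hsplit, h0, add_zero]

/-- An unreachable vertex has degree `0` in the `x`-cluster. -/
theorem deg_cluster_eq_zero {F : Finset (Sym2 V)} {x v : V} (hv : ¬ (SimpleGraph.fromEdgeSet ((F : Finset (Sym2 V)) : Set (Sym2 V))).Reachable x v) :
    #(Finset.filter (fun e => v ∈ e) ((Finset.filter (fun e => ∃ v ∈ e, (SimpleGraph.fromEdgeSet ((F : Finset (Sym2 V)) : Set (Sym2 V))).Reachable x v) F))) = 0 :=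
  card_filter_mem_eq_zero_of_not_rch (filter_cluster_idem F x) (by rwa [rch_cluster_iff])

end Graph

/-! ### The fibre bijection `F ↦ F ∖ K`, `R ↦ K ∪ R` over a fixed self-clustered `K` -/

section Fibre

variable {V : Type*} [Fintype V] [DecidableEq V] (G : SimpleGraph V) [DecidableRel G.Adj]

/-- Membership in the depleted volume. -/
theorem mem_dVol {K : Finset (Sym2 V)} {x v : V} : v ∈ (Finset.filter (fun v => ¬ (SimpleGraph.fromEdgeSet ((K : Finset (Sym2 V)) : Set (Sym2 V))).Reachable x v) Finset.univ) ↔ ¬ (SimpleGraph.fromEdgeSet ((K : Finset (Sym2 V)) : Set (Sym2 V))).Reachable x v := by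
  simp

/-- Adding edges avoiding the cluster does not change the depleted volume. -/
theorem dVol_union_eq {K R : Finset (Sym2 V)} {x : V} (hR : ∀ e ∈ R, ∀ v ∈ e, ¬ (SimpleGraph.fromEdgeSet ((K : Finset (Sym2 V)) : Set (Sym2 V))).Reachable x v) :
    (Finset.filter (fun v => ¬ (SimpleGraph.fromEdgeSet ((K ∪ R : Finset (Sym2 V)) : Set (Sym2 V))).Reachable x v) Finset.univ) = (Finset.filter (fun v => ¬ (SimpleGraph.fromEdgeSet ((K : Finset (Sym2 V)) : Set (Sym2 V))).Reachable x v) Finset.univ) := by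
  ext v; simp only [mem_filter, mem_univ, true_and, rch_union_iff hR]

/-- `tJoins G univ S` membership: edge set of `G` with odd-degree set `S`. -/
theorem mem_tJoins_univ {S : Finset V} {F : Finset (Sym2 V)} :
    F ∈ tJoins G Set.univ S ↔ F ⊆ G.edgeFinset ∧ ∀ v, Odd #(Finset.filter (fun e => v ∈ e) F) ↔ v ∈ S := by
  rw [mem_tJoins]
  simp only [Set.subset_univ, true_and]

/-- **Fibre sum.** Fix a self-clustered `K ⊆ E(G)` at `x` with odd-degree set `S₀` and a terminal
set `T` inside the depleted volume `Λ = (Finset.filter (fun v => ¬ (SimpleGraph.fromEdgeSet ((K : Finset (Sym2 V)) : Set (Sym2 V))).Reachable x v) Finset.univ)`. Then `F ↦ F ∖ K` is a bijection from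
`{F ∈ 𝒯_{S₀ ∪ T}(G) : K_x(F) = K}` onto `{R ⊆ ℰ_Λ : oddVerts Λ R = T}`, with inverse `R ↦ K ∪ R`;
in particular the corresponding sums of any `g` agree. -/
theorem fibre_sum {K : Finset (Sym2 V)} {x : V} {S₀ T : Finset V} (hKG : K ⊆ G.edgeFinset)
    (hKself : (Finset.filter (fun e => ∃ v ∈ e, (SimpleGraph.fromEdgeSet ((K : Finset (Sym2 V)) : Set (Sym2 V))).Reachable x v) K) = K) (hKodd : ∀ v, Odd #(Finset.filter (fun e => v ∈ e) K) ↔ v ∈ S₀)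
    (hT : T ⊆ (Finset.filter (fun v => ¬ (SimpleGraph.fromEdgeSet ((K : Finset (Sym2 V)) : Set (Sym2 V))).Reachable x v) Finset.univ)) (g : Finset (Sym2 V) → ℝ) :
    ∑ F ∈ (tJoins G Set.univ (S₀ ∪ T)).filter (fun F => (Finset.filter (fun e => ∃ v ∈ e, (SimpleGraph.fromEdgeSet ((F : Finset (Sym2 V)) : Set (Sym2 V))).Reachable x v) F) = K), g F =
      ∑ R ∈ (edgesIn G (Finset.filter (fun v => ¬ (SimpleGraph.fromEdgeSet ((K : Finset (Sym2 V)) : Set (Sym2 V))).Reachable x v) Finset.univ)).powerset.filter (fun R => oddVerts (Finset.filter (fun v => ¬ (SimpleGraph.fromEdgeSet ((K : Finset (Sym2 V)) : Set (Sym2 V))).Reachable x v) Finset.univ) R = T),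
        g (K ∪ R) := by
  -- vertices of S₀ are reachable
  have hS₀ : ∀ v ∈ S₀, (SimpleGraph.fromEdgeSet ((K : Finset (Sym2 V)) : Set (Sym2 V))).Reachable x v := fun v hv =>
    rch_of_card_filter_mem_ne_zero hKself (fun h0 => by
      have := (hKodd v).2 hv; rw [h0] at this; exact Nat.not_odd_zero this)
  refine Finset.sum_bij' (fun F _ => F \ K) (fun R _ => K ∪ R) ?_ ?_ ?_ ?_ ?_
  · -- `F ↦ F \ K` lands in the `T`-subgraphs of the depleted volume
    intro F hF
    rw [mem_filter] at hF
    obtain ⟨hF, hcl⟩ := hF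
    rw [mem_tJoins_univ] at hF
    obtain ⟨hFG, hFodd⟩ := hF
    have havoid : ∀ e ∈ F \ K, ∀ v ∈ e, ¬ (SimpleGraph.fromEdgeSet ((K : Finset (Sym2 V)) : Set (Sym2 V))).Reachable x v := by
      have := sdiff_cluster_avoid F x
      rw [hcl] at this
      exact this
    have hdisj : Disjoint K (F \ K) := disjoint_sdiff
    have hKF : K ⊆ F := by rw [← hcl]; exact filter_cluster_subset F x
    rw [mem_filter, mem_powerset]
    refine ⟨fun e he => ?_, ?_⟩
    · rw [mem_edgesIn_iff]
      refine ⟨SimpleGraph.mem_edgeFinset.1 (hFG (mem_sdiff.1 he).1), fun v hv => ?_⟩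
      exact mem_dVol.2 (havoid e he v hv)
    · ext v
      rw [oddVerts, mem_filter, mem_dVol]
      have hdeg : #(Finset.filter (fun e => v ∈ e) F) = #(Finset.filter (fun e => v ∈ e) K) + #(Finset.filter (fun e => v ∈ e) (F \ K)) := by
        rw [← card_filter_mem_union hdisj, union_sdiff_of_subset hKF]
      constructor
      · rintro ⟨hv, hodd⟩
        rw [card_filter_mem_eq_zero_of_not_rch hKself hv, zero_add] at hdeg
        have hodd' : Odd #(Finset.filter (fun e => v ∈ e) F) := by rw [hdeg]; exact hodd
        have hvS := (hFodd v).1 hodd'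
        rcases mem_union.1 hvS with h | h
        · exact absurd (hS₀ v h) hv
        · exact h
      · intro hvT
        have hv : ¬ (SimpleGraph.fromEdgeSet ((K : Finset (Sym2 V)) : Set (Sym2 V))).Reachable x v := mem_dVol.1 (hT hvT)
        refine ⟨hv, ?_⟩
        rw [card_filter_mem_eq_zero_of_not_rch hKself hv, zero_add] at hdeg
        have h1 : Odd #(Finset.filter (fun e => v ∈ e) F) := (hFodd v).2 (mem_union_right _ hvT)
        rw [hdeg] at h1
        exact h1
  · -- `R ↦ K ∪ R` lands in the fibre
    intro R hR
    rw [mem_filter, mem_powerset] at hR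
    obtain ⟨hRE, hRodd⟩ := hR
    have havoid : ∀ e ∈ R, ∀ v ∈ e, ¬ (SimpleGraph.fromEdgeSet ((K : Finset (Sym2 V)) : Set (Sym2 V))).Reachable x v := fun e he v hv =>
      mem_dVol.1 ((mem_edgesIn_iff.1 (hRE he)).2 v hv)
    have hdisj : Disjoint K R := disjoint_of_avoid hKself havoid
    rw [mem_filter, mem_tJoins_univ]
    refine ⟨⟨?_, fun v => ?_⟩, filter_cluster_union_eq hKself havoid⟩
    · intro e he
      rcases mem_union.1 he with h | h
      · exact hKG h
      · exact SimpleGraph.mem_edgeFinset.2 (mem_edgesIn_iff.1 (hRE h)).1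
    · rw [card_filter_mem_union hdisj]
      by_cases hv : (SimpleGraph.fromEdgeSet ((K : Finset (Sym2 V)) : Set (Sym2 V))).Reachable x v
      · have h0 : #(Finset.filter (fun e => v ∈ e) R) = 0 :=
          card_filter_mem_eq_zero_of_avoid fun e he hve => havoid e he v hve hv
        rw [h0, add_zero, hKodd v, mem_union]
        constructor
        · exact Or.inl
        · rintro (h | h)
          · exact h
          · exact absurd hv (mem_dVol.1 (hT h))
      · rw [card_filter_mem_eq_zero_of_not_rch hKself hv, zero_add, mem_union]
        have hvΛ : v ∈ (Finset.filter (fun v => ¬ (SimpleGraph.fromEdgeSet ((K : Finset (Sym2 V)) : Set (Sym2 V))).Reachable x v) Finset.univ) := mem_dVol.2 hv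
        have key : Odd #(Finset.filter (fun e => v ∈ e) R) ↔ v ∈ T := by
          rw [← hRodd, oddVerts, mem_filter]
          exact ⟨fun h => ⟨hvΛ, h⟩, fun h => h.2⟩
        rw [key]
        constructor
        · exact Or.inr
        · rintro (h | h)
          · exact absurd (hS₀ v h) hv
          · exact h
  · -- left inverse
    intro F hF
    rw [mem_filter] at hF
    have hKF : K ⊆ F := by rw [← hF.2]; exact filter_cluster_subset F x
    exact union_sdiff_of_subset hKF
  · -- right inverse
    intro R hR
    rw [mem_filter, mem_powerset] at hR
    have havoid : ∀ e ∈ R, ∀ v ∈ e, ¬ (SimpleGraph.fromEdgeSet ((K : Finset (Sym2 V)) : Set (Sym2 V))).Reachable x v := fun e he v hv =>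
      mem_dVol.1 ((mem_edgesIn_iff.1 (hR.1 he)).2 v hv)
    exact union_sdiff_cancel_left (disjoint_of_avoid hKself havoid)
  · -- summand
    intro F hF
    rw [mem_filter] at hF
    have hKF : K ⊆ F := by rw [← hF.2]; exact filter_cluster_subset F x
    rw [union_sdiff_of_subset hKF]

end Fibre

end Summit.CriticalPhenomena.Ising3DConformalLimit.Theorems.DepletionBound

end
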